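import Literature.MathematicalPhysics.QuantumFieldTheory.Balaban1983to89.Node00.N24BetaFromB3
import Literature.MathematicalPhysics.QuantumFieldTheory.Balaban1983to89.Node00.N24KnitPinned
import Literature.MathematicalPhysics.QuantumFieldTheory.Balaban1983to89.Node00.N03Record

/-!
# NODE N24 · N03 ENTERED AS A THEOREM: the N24 glue ∕ knits at `₅C` and `₈C` with the child N03 = [Balaban1984PropagatorsII] DISCHARGED BY NAME at every record
# (`Node00.N03_at_record₅C`, seat dag-p1 = n03-a, p413711 — hypothesis-free: the Prop. 2.6 census is a tree theorem, `N03_prop26_census`), so that neither the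
# binder `h03` nor the census slot `h26` appears any more; combined with the F-n24T-1 `_pinned` knits (module 11) and the β-window-from-B3 faces (module 12)

TRACK A (YM-PLAN §2d, node N24 of 28), seat `pub-ymgap-dag-n24-a` (-a KNIT-BY-NAME).  THIRTEENTH N24 module, a NEW importing one (append-only growth).  After this file
the kernel list «which child blocks N24» reads: THEOREMS at every `₅C`∕`₈C` record — N01, N02, **N03**, N04 (and N23 for B1), `hC`, `hγ`, guarded (0.20), the β-window GIVEN
B3; BY NAME MODULO DISPLAYED SLOTS — N08 (B10₅), N10 (B13₅), N11 ((P1₅)(P3₅)(S0)(S1)), N13 ((R) := the world's leaf + five Cor.-3 leaves); PURE BINDERS — N05 [B8], N06 [B9],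
N07 [B11], N09 [B12], N12 [B15]; UPSTREAM — B3 = N25 (NODE O).  THEOREMS ONLY, def-free, sorry-free, standard axioms; one-line compositions by name.

* §1 at `₅C`: `N24_at_record₅C_knit₀₃` (nine binders N05–N13 + β-box), `N24_at_record₅C_knit₀₃₀₈₁₀₁₁₁₃_pinned` (five binders + the four children's slots, 𝐑-slot pinned,
  + β-box), `N24_binders₅C_final_pinned` (WHICH CHILD BLOCKS: the five pure binders ⇒ (B2) given the slots and the β-box — no census hypothesis left).
* §2 at `₈C`: `N24_at_record₈C_knit₀₃`, `N24_at_record₈C_knit₀₃_of_betaMerged_pinned` (β at the merged β of record), `N24_binders₈C_final_pinned`.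
* §3 GIVEN B3 (module 12's lowering): `N24_at_record₅C_lowered_of_betaPertH_knit₀₃` ∕ `…₈C…` — at the explicit γ-lowered record world the NINE children N05–N13 suffice;
  `N24_lowered_binders₅C_of_betaPertH_pinned` — the same with N08 ∕ N10 knit by their γ-BLIND slots (they read only `w.up = w'.up`) and N11 ∕ N13 by their slots AT THE
  LOWERED WORLD (N11's (S0)(S1) antecedents and N13's Cor.-3 radius read the window, so they are displayed at `w'`): inputs = a `₅C` record + B3 + N08∕N10 slots; output =
  an explicit `w'` at which «five pure binders + N11's slots + N13's pinned leaf and Cor.-3 leaves ⇒ (B2)».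
NOTE N-n24-12 (referee dag-ref-D, READ #49, carried here for modules 12–13): the joint antecedent «`IsRecordOfRecord₅C∕₈C F N D w` ∧ `0 < β̄` ∧ `BetaPertH D.βfun β̄`» of the
B3-lowered theorems (§3 here, module 12 §3) is NOT exhibited inhabited, and NO typed realiser of record witnesses it: module 11's `₅C` witness and the intended `ρ8 := 0`
`₈C` witness (n23-b `Record8Inhabited`) carry a zero ∕ junk β, for which `|0 − β̄| ≤ C γ²` at all small `γ` forces `β̄ = 0`.  Those theorems are correct, non-vacuous
implications (a positive-constant merged β would satisfy B3 with `C = 0`) whose antecedent is exactly NODE O's OPEN content: B3 at Stage 8 is N25's — no typed realiser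
satisfies B3 yet.  (Director-ym LINE №31 ∕ ref-D ZEROCHART v0.33: no `∃`-form claim over the `₈C` predicate is made anywhere in the N24 modules; every theorem is an
implication AT a given record.)
HONEST FRAMING: kernel bookkeeping BY NAME; N03's entry is n03-a's theorem (N03 DISCHARGED OF RECORD, chair R443 — the count is the chair's, R417); every remaining slot ∕
bound ∕ B3 a displayed HYPOTHESIS; N24 COMPOSITE — no discharge, no count; one finite T⁴ programme at fixed ε; NOT continuum ∕ ℝ⁴ ∕ OS ∕ mass gap ∕ Clay.
-/

noncomputable section

open scoped Matrix.Norms.L2Operator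

namespace Literature.MathematicalPhysics.QuantumFieldTheory.Balaban1983to89.Node00

open DagBinding T4Continuum T4DatumAssembly FlowStep

variable {F : T4Family} {N : ℕ} [NeZero N] {D : FiniteEpsData F (SU N)} {w : WorldP}

/-! ## §1. At `₅C` with N03 a theorem -/

/-- **N24 · (B2) at a `₅C` record, N03 BY NAME as a theorem** (`N03_at_record₅C`): the NINE open children N05–N13 as binders at the record world + the β-box bounds.
[cite: Balaban1989LargeFieldII, Thm 1 p.355 + p.391; Balaban1984PropagatorsII, Lemma 2.1 – Cor. 2.8 pp.234–249; Balaban1987RG1, (1.22) p.264 (bookkeeping)] -/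
theorem N24_at_record₅C_knit₀₃ (h : IsRecordOfRecord₅C F N D w) {γ₀ : ℝ} (hγ₀ : w.γ ≤ γ₀)
    (h05 : ∀ P : B12.RunParams, Dag.B8_main (leavesP w P))
    (h06 : ∀ P : B12.RunParams, Dag.B9_main (leavesP w P)) (h07 : ∀ P : B12.RunParams, Dag.B11_main (leavesP w P))
    (h08 : ∀ P : B12.RunParams, Dag.B10_main (leavesP w P)) (h09 : ∀ P : B12.RunParams, Dag.B12_main (leavesP w P))
    (h10 : ∀ P : B12.RunParams, Dag.B13_main (leavesP w P)) (h11 : ∀ P : B12.RunParams, Dag.B14_main (leavesP w P))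
    (h12 : ∀ P : B12.RunParams, Dag.B15_main (leavesP w P)) (h13 : ∀ P : B12.RunParams, Dag.B16_main (leavesP w P))
    (hlo : BetaLowerH w.b γ₀ D.βfun) (hhi : BetaUpperH w.βup γ₀ D.βfun) :
    B16.EndStatementBPrinted D.C :=
  N24_at_record₅C h hγ₀ (N03_at_record₅C h) h05 h06 h07 h08 h09 h10 h11 h12 h13 hlo hhi

/-- **N24 · (B2) at a `₅C` record with N03 a theorem and N08, N10, N11, N13 knit by name (𝐑-slot pinned)**: the FIVE pure binders N05, N06, N07, N09, N12 + the four
children's displayed slots + the β-box bounds. [cite: Balaban1989LargeFieldII, Thm 1 p.355 + pp.387, 391; Balaban1984PropagatorsII, pp.234–249; Balaban1985UV3, Thm 1 p.257 + Thm 2 p.272; Balaban1988RG2Cluster, Lemmas 1–3 pp.9, 11, 20; Balaban1988Convergent, Thm 1 p.262, Theorem p.245, p.244, Cor. 3 (2.50) p.264; Balaban1987RG1, (1.22) p.264 (bookkeeping)] -/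
theorem N24_at_record₅C_knit₀₃₀₈₁₀₁₁₁₃_pinned (h : IsRecordOfRecord₅C F N D w) {γ₀ : ℝ} (hγ₀ : w.γ ≤ γ₀)
    (h05 : ∀ P : B12.RunParams, Dag.B8_main (leavesP w P))
    (h06 : ∀ P : B12.RunParams, Dag.B9_main (leavesP w P)) (h07 : ∀ P : B12.RunParams, Dag.B11_main (leavesP w P))
    (h09 : ∀ P : B12.RunParams, Dag.B12_main (leavesP w P)) (h12 : ∀ P : B12.RunParams, Dag.B15_main (leavesP w P))
    (slots₀₈ : ∀ θ : Stage5Params F N, θ.Admissible → D = datumOfRecord₅ F N θ →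
      (∀ P, w.up P = upOfRecord₅C F N θ P) → ∀ P : B12.RunParams,
        ∃ (Xc : PrintedCarriersR) (I : Type) (C : B10Assembly.Consts) (T : I → B10.TowerRun),
          Nonempty (∀ i, B10Assembly.LeafSystem C (T i)) ∧ θ.res.X P = Xc.withTowerRuns10 T)
    (slots₁₀ : ∀ θ : Stage5Params F N, θ.Admissible → D = datumOfRecord₅ F N θ →
      (∀ P, w.up P = upOfRecord₅C F N θ P) → ∀ P : B12.RunParams,
        B9LeafX (θ.res.Y P) →
          (B10.Thm1PrintedCompact (θ.res.X P).runs10 ∧ B10.Thm2Printed (θ.res.X P).runs10) →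
            B11Leaf (θ.res.Z P) → B12Sec2to5.Lemma4Printed (θ.res.X P).F12 (θ.res.X P).c12 →
              B13.Lemma1Printed (θ.res.X P).S13 (θ.res.X P).c13 ∧ B13.Lemma2Printed (θ.res.X P).S13 (θ.res.X P).c13 ∧
                B13.Lemma3Printed (θ.res.X P).S13 (θ.res.X P).c13)
    (slots₁₁ : ∀ θ : Stage5Params F N, θ.Admissible → D = datumOfRecord₅ F N θ →
      (∀ P, w.up P = upOfRecord₅C F N θ P) → ∀ P : B12.RunParams,
        ∃ S Scorr : (k : ℕ) → Density (F.P P.K) k (SU N) → Prop,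
          (ROpLeaf (θ.res.V P) → B14.RAssumedP244 (θ.res.R P) Scorr S P.K) ∧
          (∀ k, k ≤ P.K → S k (densOfRecord₅ F N θ P k) → θ.res.S218 P k (densOfRecord₅ F N θ P k)) ∧
          ((leavesP w P).smallCouplings → S 0 (rhoZeroOfRecord F N P.K P.g0 (θ.res.E P))) ∧
          ((leavesP w P).b7 → (leavesP w P).b8 → (leavesP w P).b9 → (leavesP w P).b10 → (leavesP w P).b11 →
            (leavesP w P).smallCouplings → (leavesP w P).smallFieldInductive → (leavesP w P).flowControl →
              ∀ k, k < P.K → S k (densOfRecord₅ F N θ P k) →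
                Scorr (k + 1) (TrhoOfRecord F N P.K k (densOfRecord₅ F N θ P k))))
    (eM eP : FiniteEpsData F (SU N) → ℝ → ℝ) (hR : ∀ P : B12.RunParams, (w.up P).rOperation)
    (hcor : ∀ θ : Stage5Params F N, θ.Admissible → D = datumOfRecord₅ F N θ →
      ∃ R : B14Cor3.ReprFamily (datumOfRecord₅ F N θ).C,
        B14Cor3.LeafH (datumOfRecord₅ F N θ).C R w.γ ∧ B14Cor3.LeafU1 (datumOfRecord₅ F N θ).C R w.γ ∧
        B14Cor3.LeafU2 (datumOfRecord₅ F N θ).C R w.γ (eP D) ∧ B14Cor3.LeafL1 (datumOfRecord₅ F N θ).C R w.γ ∧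
        B14Cor3.LeafL2 (datumOfRecord₅ F N θ).C R w.γ (eM D))
    (hlo : BetaLowerH w.b γ₀ D.βfun) (hhi : BetaUpperH w.βup γ₀ D.βfun) :
    B16.EndStatementBPrinted D.C :=
  N24_at_record₅C_knit₀₈₁₀₁₁₁₃_pinned h hγ₀ (N03_at_record₅C h) h05 h06 h07 h09 h12 slots₀₈ slots₁₀ slots₁₁ eM eP hR hcor hlo hhi

/-- **WHICH CHILD BLOCKS at `₅C`, final binder list in kernel form**: the FIVE pure child binders N05 [B8], N06 [B9], N07 [B11], N09 [B12], N12 [B15] at the record world imply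
(B2), given N08 ∕ N10 ∕ N11's slots, N13's world-leaf 𝐑 + exponent families + Cor.-3 leaves and the β-box bounds — N01–N04 being theorems of the record.  One implication,
every antecedent displayed. [cite: Balaban1989LargeFieldII, Thm 1 p.355 + p.391 (bookkeeping: the residual binder list of N24)] -/
theorem N24_binders₅C_final_pinned (h : IsRecordOfRecord₅C F N D w) {γ₀ : ℝ} (hγ₀ : w.γ ≤ γ₀)
    (slots₀₈ : ∀ θ : Stage5Params F N, θ.Admissible → D = datumOfRecord₅ F N θ →
      (∀ P, w.up P = upOfRecord₅C F N θ P) → ∀ P : B12.RunParams,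
        ∃ (Xc : PrintedCarriersR) (I : Type) (C : B10Assembly.Consts) (T : I → B10.TowerRun),
          Nonempty (∀ i, B10Assembly.LeafSystem C (T i)) ∧ θ.res.X P = Xc.withTowerRuns10 T)
    (slots₁₀ : ∀ θ : Stage5Params F N, θ.Admissible → D = datumOfRecord₅ F N θ →
      (∀ P, w.up P = upOfRecord₅C F N θ P) → ∀ P : B12.RunParams,
        B9LeafX (θ.res.Y P) →
          (B10.Thm1PrintedCompact (θ.res.X P).runs10 ∧ B10.Thm2Printed (θ.res.X P).runs10) →
            B11Leaf (θ.res.Z P) → B12Sec2to5.Lemma4Printed (θ.res.X P).F12 (θ.res.X P).c12 →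
              B13.Lemma1Printed (θ.res.X P).S13 (θ.res.X P).c13 ∧ B13.Lemma2Printed (θ.res.X P).S13 (θ.res.X P).c13 ∧
                B13.Lemma3Printed (θ.res.X P).S13 (θ.res.X P).c13)
    (slots₁₁ : ∀ θ : Stage5Params F N, θ.Admissible → D = datumOfRecord₅ F N θ →
      (∀ P, w.up P = upOfRecord₅C F N θ P) → ∀ P : B12.RunParams,
        ∃ S Scorr : (k : ℕ) → Density (F.P P.K) k (SU N) → Prop,
          (ROpLeaf (θ.res.V P) → B14.RAssumedP244 (θ.res.R P) Scorr S P.K) ∧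
          (∀ k, k ≤ P.K → S k (densOfRecord₅ F N θ P k) → θ.res.S218 P k (densOfRecord₅ F N θ P k)) ∧
          ((leavesP w P).smallCouplings → S 0 (rhoZeroOfRecord F N P.K P.g0 (θ.res.E P))) ∧
          ((leavesP w P).b7 → (leavesP w P).b8 → (leavesP w P).b9 → (leavesP w P).b10 → (leavesP w P).b11 →
            (leavesP w P).smallCouplings → (leavesP w P).smallFieldInductive → (leavesP w P).flowControl →
              ∀ k, k < P.K → S k (densOfRecord₅ F N θ P k) →
                Scorr (k + 1) (TrhoOfRecord F N P.K k (densOfRecord₅ F N θ P k))))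
    (eM eP : FiniteEpsData F (SU N) → ℝ → ℝ) (hR : ∀ P : B12.RunParams, (w.up P).rOperation)
    (hcor : ∀ θ : Stage5Params F N, θ.Admissible → D = datumOfRecord₅ F N θ →
      ∃ R : B14Cor3.ReprFamily (datumOfRecord₅ F N θ).C,
        B14Cor3.LeafH (datumOfRecord₅ F N θ).C R w.γ ∧ B14Cor3.LeafU1 (datumOfRecord₅ F N θ).C R w.γ ∧
        B14Cor3.LeafU2 (datumOfRecord₅ F N θ).C R w.γ (eP D) ∧ B14Cor3.LeafL1 (datumOfRecord₅ F N θ).C R w.γ ∧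
        B14Cor3.LeafL2 (datumOfRecord₅ F N θ).C R w.γ (eM D))
    (hlo : BetaLowerH w.b γ₀ D.βfun) (hhi : BetaUpperH w.βup γ₀ D.βfun) :
    ((∀ P : B12.RunParams, Dag.B8_main (leavesP w P)) → (∀ P : B12.RunParams, Dag.B9_main (leavesP w P)) →
      (∀ P : B12.RunParams, Dag.B11_main (leavesP w P)) → (∀ P : B12.RunParams, Dag.B12_main (leavesP w P)) →
      (∀ P : B12.RunParams, Dag.B15_main (leavesP w P)) → B16.EndStatementBPrinted D.C) :=
  fun h05 h06 h07 h09 h12 =>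
    N24_at_record₅C_knit₀₃₀₈₁₀₁₁₁₃_pinned h hγ₀ h05 h06 h07 h09 h12 slots₀₈ slots₁₀ slots₁₁ eM eP hR hcor hlo hhi

/-! ## §2. At `₈C` with N03 a theorem -/

/-- **N24 · (B2) at a Stage-8 record, N03 BY NAME as a theorem** (through the refinement `₈C → ₅C`): nine binders N05–N13 + the β-box bounds on `D.βfun`.
[cite: Balaban1989LargeFieldII, Thm 1 p.355 + p.391; Balaban1984PropagatorsII, pp.234–249; Balaban1987RG1, (1.22) p.264 (bookkeeping)] -/
theorem N24_at_record₈C_knit₀₃ (h : IsRecordOfRecord₈C F N D w) {γ₀ : ℝ} (hγ₀ : w.γ ≤ γ₀)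
    (h05 : ∀ P : B12.RunParams, Dag.B8_main (leavesP w P))
    (h06 : ∀ P : B12.RunParams, Dag.B9_main (leavesP w P)) (h07 : ∀ P : B12.RunParams, Dag.B11_main (leavesP w P))
    (h08 : ∀ P : B12.RunParams, Dag.B10_main (leavesP w P)) (h09 : ∀ P : B12.RunParams, Dag.B12_main (leavesP w P))
    (h10 : ∀ P : B12.RunParams, Dag.B13_main (leavesP w P)) (h11 : ∀ P : B12.RunParams, Dag.B14_main (leavesP w P))
    (h12 : ∀ P : B12.RunParams, Dag.B15_main (leavesP w P)) (h13 : ∀ P : B12.RunParams, Dag.B16_main (leavesP w P))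
    (hlo : BetaLowerH w.b γ₀ D.βfun) (hhi : BetaUpperH w.βup γ₀ D.βfun) :
    B16.EndStatementBPrinted D.C :=
  N24_at_record₈C h hγ₀ (N03_at_record₅C (isRecordOfRecord₅C_of_isRecordOfRecord₈C h)) h05 h06 h07 h08 h09 h10 h11 h12 h13 hlo hhi

/-- **N24 at a Stage-8 record with N03 a theorem, N08 ∕ N10 ∕ N11 ∕ N13 knit by name (𝐑-slot pinned), β at the MERGED β of record** on the world's box.
[cite: Balaban1989LargeFieldII, Thm 1 p.355 + pp.387, 391; Balaban1987RG1, (1.20)–(1.22) p.264; Balaban1984PropagatorsII, pp.234–249; Balaban1985UV3, Thm 1 p.257 + Thm 2 p.272; Balaban1988RG2Cluster, Lemmas 1–3 pp.9, 11, 20; Balaban1988Convergent, Thm 1 p.262, Cor. 3 (2.50) p.264 (bookkeeping)] -/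
theorem N24_at_record₈C_knit₀₃_of_betaMerged_pinned (h : IsRecordOfRecord₈C F N D w)
    (h05 : ∀ P : B12.RunParams, Dag.B8_main (leavesP w P))
    (h06 : ∀ P : B12.RunParams, Dag.B9_main (leavesP w P)) (h07 : ∀ P : B12.RunParams, Dag.B11_main (leavesP w P))
    (h09 : ∀ P : B12.RunParams, Dag.B12_main (leavesP w P)) (h12 : ∀ P : B12.RunParams, Dag.B15_main (leavesP w P))
    (slots₀₈ : ∀ θ : Stage5Params F N, θ.Admissible → D = datumOfRecord₅ F N θ →
      (∀ P, w.up P = upOfRecord₅C F N θ P) → ∀ P : B12.RunParams,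
        ∃ (Xc : PrintedCarriersR) (I : Type) (C : B10Assembly.Consts) (T : I → B10.TowerRun),
          Nonempty (∀ i, B10Assembly.LeafSystem C (T i)) ∧ θ.res.X P = Xc.withTowerRuns10 T)
    (slots₁₀ : ∀ θ : Stage5Params F N, θ.Admissible → D = datumOfRecord₅ F N θ →
      (∀ P, w.up P = upOfRecord₅C F N θ P) → ∀ P : B12.RunParams,
        B9LeafX (θ.res.Y P) →
          (B10.Thm1PrintedCompact (θ.res.X P).runs10 ∧ B10.Thm2Printed (θ.res.X P).runs10) →
            B11Leaf (θ.res.Z P) → B12Sec2to5.Lemma4Printed (θ.res.X P).F12 (θ.res.X P).c12 →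
              B13.Lemma1Printed (θ.res.X P).S13 (θ.res.X P).c13 ∧ B13.Lemma2Printed (θ.res.X P).S13 (θ.res.X P).c13 ∧
                B13.Lemma3Printed (θ.res.X P).S13 (θ.res.X P).c13)
    (slots₁₁ : ∀ θ : Stage5Params F N, θ.Admissible → D = datumOfRecord₅ F N θ →
      (∀ P, w.up P = upOfRecord₅C F N θ P) → ∀ P : B12.RunParams,
        ∃ S Scorr : (k : ℕ) → Density (F.P P.K) k (SU N) → Prop,
          (ROpLeaf (θ.res.V P) → B14.RAssumedP244 (θ.res.R P) Scorr S P.K) ∧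
          (∀ k, k ≤ P.K → S k (densOfRecord₅ F N θ P k) → θ.res.S218 P k (densOfRecord₅ F N θ P k)) ∧
          ((leavesP w P).smallCouplings → S 0 (rhoZeroOfRecord F N P.K P.g0 (θ.res.E P))) ∧
          ((leavesP w P).b7 → (leavesP w P).b8 → (leavesP w P).b9 → (leavesP w P).b10 → (leavesP w P).b11 →
            (leavesP w P).smallCouplings → (leavesP w P).smallFieldInductive → (leavesP w P).flowControl →
              ∀ k, k < P.K → S k (densOfRecord₅ F N θ P k) →
                Scorr (k + 1) (TrhoOfRecord F N P.K k (densOfRecord₅ F N θ P k))))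
    (eM eP : FiniteEpsData F (SU N) → ℝ → ℝ) (hR : ∀ P : B12.RunParams, (w.up P).rOperation)
    (hcor : ∀ θ : Stage5Params F N, θ.Admissible → D = datumOfRecord₅ F N θ →
      ∃ R : B14Cor3.ReprFamily (datumOfRecord₅ F N θ).C,
        B14Cor3.LeafH (datumOfRecord₅ F N θ).C R w.γ ∧ B14Cor3.LeafU1 (datumOfRecord₅ F N θ).C R w.γ ∧
        B14Cor3.LeafU2 (datumOfRecord₅ F N θ).C R w.γ (eP D) ∧ B14Cor3.LeafL1 (datumOfRecord₅ F N θ).C R w.γ ∧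
        B14Cor3.LeafL2 (datumOfRecord₅ F N θ).C R w.γ (eM D))
    (hβm : ∀ θ : Stage8Params F N, θ.Admissible → D = datumOfRecord₅ F N (θ.toStage5 F N) → w.γ ≤ θ.γ →
      letI := θ.instVβ₁; letI := θ.instVβ₂; letI := θ.instιβ
      BetaLowerH w.b w.γ (betaMerged F (mergedTermFamilyMat F N (chi7 F N θ) θ.εbg) θ.ρ8 θ.bV) ∧
        BetaUpperH w.βup w.γ (betaMerged F (mergedTermFamilyMat F N (chi7 F N θ) θ.εbg) θ.ρ8 θ.bV)) :
    B16.EndStatementBPrinted D.C :=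
  N24_at_record₈C_knit_of_betaMerged_pinned h (N03_at_record₅C (isRecordOfRecord₅C_of_isRecordOfRecord₈C h)) h05 h06 h07 h09 h12
    slots₀₈ slots₁₀ slots₁₁ eM eP hR hcor hβm

/-- **WHICH CHILD BLOCKS at `₈C`, final binder list in kernel form**: the FIVE pure binders N05, N06, N07, N09, N12 ⇒ (B2), given N08 ∕ N10 ∕ N11's slots, N13's world-leaf 𝐑 +
exponent families + Cor.-3 leaves and the two bounds on the merged β of record along `]0, w.γ]^{k+1}`. [cite: Balaban1989LargeFieldII, Thm 1 p.355 + p.391; Balaban1987RG1, (1.20)–(1.22) p.264 (bookkeeping)] -/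
theorem N24_binders₈C_final_pinned (h : IsRecordOfRecord₈C F N D w)
    (slots₀₈ : ∀ θ : Stage5Params F N, θ.Admissible → D = datumOfRecord₅ F N θ →
      (∀ P, w.up P = upOfRecord₅C F N θ P) → ∀ P : B12.RunParams,
        ∃ (Xc : PrintedCarriersR) (I : Type) (C : B10Assembly.Consts) (T : I → B10.TowerRun),
          Nonempty (∀ i, B10Assembly.LeafSystem C (T i)) ∧ θ.res.X P = Xc.withTowerRuns10 T)
    (slots₁₀ : ∀ θ : Stage5Params F N, θ.Admissible → D = datumOfRecord₅ F N θ →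
      (∀ P, w.up P = upOfRecord₅C F N θ P) → ∀ P : B12.RunParams,
        B9LeafX (θ.res.Y P) →
          (B10.Thm1PrintedCompact (θ.res.X P).runs10 ∧ B10.Thm2Printed (θ.res.X P).runs10) →
            B11Leaf (θ.res.Z P) → B12Sec2to5.Lemma4Printed (θ.res.X P).F12 (θ.res.X P).c12 →
              B13.Lemma1Printed (θ.res.X P).S13 (θ.res.X P).c13 ∧ B13.Lemma2Printed (θ.res.X P).S13 (θ.res.X P).c13 ∧
                B13.Lemma3Printed (θ.res.X P).S13 (θ.res.X P).c13)
    (slots₁₁ : ∀ θ : Stage5Params F N, θ.Admissible → D = datumOfRecord₅ F N θ →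
      (∀ P, w.up P = upOfRecord₅C F N θ P) → ∀ P : B12.RunParams,
        ∃ S Scorr : (k : ℕ) → Density (F.P P.K) k (SU N) → Prop,
          (ROpLeaf (θ.res.V P) → B14.RAssumedP244 (θ.res.R P) Scorr S P.K) ∧
          (∀ k, k ≤ P.K → S k (densOfRecord₅ F N θ P k) → θ.res.S218 P k (densOfRecord₅ F N θ P k)) ∧
          ((leavesP w P).smallCouplings → S 0 (rhoZeroOfRecord F N P.K P.g0 (θ.res.E P))) ∧
          ((leavesP w P).b7 → (leavesP w P).b8 → (leavesP w P).b9 → (leavesP w P).b10 → (leavesP w P).b11 →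
            (leavesP w P).smallCouplings → (leavesP w P).smallFieldInductive → (leavesP w P).flowControl →
              ∀ k, k < P.K → S k (densOfRecord₅ F N θ P k) →
                Scorr (k + 1) (TrhoOfRecord F N P.K k (densOfRecord₅ F N θ P k))))
    (eM eP : FiniteEpsData F (SU N) → ℝ → ℝ) (hR : ∀ P : B12.RunParams, (w.up P).rOperation)
    (hcor : ∀ θ : Stage5Params F N, θ.Admissible → D = datumOfRecord₅ F N θ →
      ∃ R : B14Cor3.ReprFamily (datumOfRecord₅ F N θ).C,
        B14Cor3.LeafH (datumOfRecord₅ F N θ).C R w.γ ∧ B14Cor3.LeafU1 (datumOfRecord₅ F N θ).C R w.γ ∧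
        B14Cor3.LeafU2 (datumOfRecord₅ F N θ).C R w.γ (eP D) ∧ B14Cor3.LeafL1 (datumOfRecord₅ F N θ).C R w.γ ∧
        B14Cor3.LeafL2 (datumOfRecord₅ F N θ).C R w.γ (eM D))
    (hβm : ∀ θ : Stage8Params F N, θ.Admissible → D = datumOfRecord₅ F N (θ.toStage5 F N) → w.γ ≤ θ.γ →
      letI := θ.instVβ₁; letI := θ.instVβ₂; letI := θ.instιβ
      BetaLowerH w.b w.γ (betaMerged F (mergedTermFamilyMat F N (chi7 F N θ) θ.εbg) θ.ρ8 θ.bV) ∧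
        BetaUpperH w.βup w.γ (betaMerged F (mergedTermFamilyMat F N (chi7 F N θ) θ.εbg) θ.ρ8 θ.bV)) :
    ((∀ P : B12.RunParams, Dag.B8_main (leavesP w P)) → (∀ P : B12.RunParams, Dag.B9_main (leavesP w P)) →
      (∀ P : B12.RunParams, Dag.B11_main (leavesP w P)) → (∀ P : B12.RunParams, Dag.B12_main (leavesP w P)) →
      (∀ P : B12.RunParams, Dag.B15_main (leavesP w P)) → B16.EndStatementBPrinted D.C) :=
  fun h05 h06 h07 h09 h12 =>
    N24_at_record₈C_knit₀₃_of_betaMerged_pinned h h05 h06 h07 h09 h12 slots₀₈ slots₁₀ slots₁₁ eM eP hR hcor hβm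

/-! ## §3. GIVEN B3: at the γ-lowered record world the NINE children N05–N13 suffice (N03 a theorem there too) -/

/-- **N24 at a `₅C` record GIVEN B3, N03 a theorem**: module 12's lowering with `h03` supplied at the lowered record world by `N03_at_record₅C`.
[cite: Balaban1989LargeFieldII, Thm 1 p.355 + p.391; Balaban1987RG1, (1.22) p.264; Balaban1984PropagatorsII, pp.234–249 (bookkeeping)] -/
theorem N24_at_record₅C_lowered_of_betaPertH_knit₀₃ (h : IsRecordOfRecord₅C F N D w) {βbar : ℝ} (hbar : 0 < βbar)
    (hP : BetaPertH D.βfun βbar) :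
    ∃ w' : WorldP, IsRecordOfRecord₅C F N D w' ∧ w'.C = w.C ∧ w'.up = w.up ∧ w'.L = w.L ∧ w'.em = w.em ∧ w'.ep = w.ep ∧
      0 < w'.γ ∧ w'.γ ≤ w.γ ∧
      ((∀ P : B12.RunParams, Dag.B8_main (leavesP w' P)) →
        (∀ P : B12.RunParams, Dag.B9_main (leavesP w' P)) → (∀ P : B12.RunParams, Dag.B11_main (leavesP w' P)) →
        (∀ P : B12.RunParams, Dag.B10_main (leavesP w' P)) → (∀ P : B12.RunParams, Dag.B12_main (leavesP w' P)) →
        (∀ P : B12.RunParams, Dag.B13_main (leavesP w' P)) → (∀ P : B12.RunParams, Dag.B14_main (leavesP w' P)) →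
        (∀ P : B12.RunParams, Dag.B15_main (leavesP w' P)) → (∀ P : B12.RunParams, Dag.B16_main (leavesP w' P)) →
        B16.EndStatementBPrinted D.C) := by
  obtain ⟨w', h', hC, hup, hL, hem, hep, hγ', hle, himp⟩ := N24_at_record₅C_lowered_of_betaPertH h hbar hP
  exact ⟨w', h', hC, hup, hL, hem, hep, hγ', hle, fun h05 h06 h07 h08 h09 h10 h11 h12 h13 =>
    himp (N03_at_record₅C h') h05 h06 h07 h08 h09 h10 h11 h12 h13⟩

/-- **The Stage-8 twin**: a `₈C` record + B3 ⇒ a γ-lowered `₈C` record world over `D` at which the nine children N05–N13 give (B2).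
[cite: Balaban1989LargeFieldII, Thm 1 p.355 + p.391; Balaban1987RG1, (1.20)–(1.22) p.264; Balaban1984PropagatorsII, pp.234–249 (bookkeeping)] -/
theorem N24_at_record₈C_lowered_of_betaPertH_knit₀₃ (h : IsRecordOfRecord₈C F N D w) {βbar : ℝ} (hbar : 0 < βbar)
    (hP : BetaPertH D.βfun βbar) :
    ∃ w' : WorldP, IsRecordOfRecord₈C F N D w' ∧ w'.C = w.C ∧ w'.up = w.up ∧ w'.L = w.L ∧ w'.em = w.em ∧ w'.ep = w.ep ∧
      0 < w'.γ ∧ w'.γ ≤ w.γ ∧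
      ((∀ P : B12.RunParams, Dag.B8_main (leavesP w' P)) →
        (∀ P : B12.RunParams, Dag.B9_main (leavesP w' P)) → (∀ P : B12.RunParams, Dag.B11_main (leavesP w' P)) →
        (∀ P : B12.RunParams, Dag.B10_main (leavesP w' P)) → (∀ P : B12.RunParams, Dag.B12_main (leavesP w' P)) →
        (∀ P : B12.RunParams, Dag.B13_main (leavesP w' P)) → (∀ P : B12.RunParams, Dag.B14_main (leavesP w' P)) →
        (∀ P : B12.RunParams, Dag.B15_main (leavesP w' P)) → (∀ P : B12.RunParams, Dag.B16_main (leavesP w' P)) →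
        B16.EndStatementBPrinted D.C) := by
  obtain ⟨w', h', hC, hup, hL, hem, hep, hγ', hle, himp⟩ := N24_at_record₈C_lowered_of_betaPertH h hbar hP
  exact ⟨w', h', hC, hup, hL, hem, hep, hγ', hle, fun h05 h06 h07 h08 h09 h10 h11 h12 h13 =>
    himp (N03_at_record₅C (isRecordOfRecord₅C_of_isRecordOfRecord₈C h')) h05 h06 h07 h08 h09 h10 h11 h12 h13⟩

/-- **N24 at a `₅C` record GIVEN B3, with N08 ∕ N10 knit by their γ-BLIND slots and N11 ∕ N13 by their slots AT THE LOWERED WORLD**: from the record, B3 and the N08 ∕ N10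
slots (which read only `w.up`, unchanged by the lowering) there is an explicit γ-lowered `₅C` record world `w'` over `D` (same `C`, `up`, `L`, exponent letters) at which
«the five pure binders N05 N06 N07 N09 N12 + N11's slots + N13's world-leaf 𝐑, exponent families and Cor.-3 leaves (displayed AT `w'`: their (S0)∕(S1) antecedents and the
Cor.-3 radius read the window) ⇒ `B16.EndStatementBPrinted D.C`». [cite: Balaban1989LargeFieldII, Thm 1 p.355 + pp.387, 391; Balaban1987RG1, (1.22) p.264; Balaban1985UV3, Thm 1 p.257 + Thm 2 p.272; Balaban1988RG2Cluster, Lemmas 1–3 pp.9, 11, 20; Balaban1988Convergent, Thm 1 p.262, p.244, Cor. 3 (2.50) p.264 (bookkeeping)] -/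
theorem N24_lowered_binders₅C_of_betaPertH_pinned (h : IsRecordOfRecord₅C F N D w) {βbar : ℝ} (hbar : 0 < βbar) (hP : BetaPertH D.βfun βbar)
    (slots₀₈ : ∀ θ : Stage5Params F N, θ.Admissible → D = datumOfRecord₅ F N θ →
      (∀ P, w.up P = upOfRecord₅C F N θ P) → ∀ P : B12.RunParams,
        ∃ (Xc : PrintedCarriersR) (I : Type) (C : B10Assembly.Consts) (T : I → B10.TowerRun),
          Nonempty (∀ i, B10Assembly.LeafSystem C (T i)) ∧ θ.res.X P = Xc.withTowerRuns10 T)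
    (slots₁₀ : ∀ θ : Stage5Params F N, θ.Admissible → D = datumOfRecord₅ F N θ →
      (∀ P, w.up P = upOfRecord₅C F N θ P) → ∀ P : B12.RunParams,
        B9LeafX (θ.res.Y P) →
          (B10.Thm1PrintedCompact (θ.res.X P).runs10 ∧ B10.Thm2Printed (θ.res.X P).runs10) →
            B11Leaf (θ.res.Z P) → B12Sec2to5.Lemma4Printed (θ.res.X P).F12 (θ.res.X P).c12 →
              B13.Lemma1Printed (θ.res.X P).S13 (θ.res.X P).c13 ∧ B13.Lemma2Printed (θ.res.X P).S13 (θ.res.X P).c13 ∧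
                B13.Lemma3Printed (θ.res.X P).S13 (θ.res.X P).c13) :
    ∃ w' : WorldP, IsRecordOfRecord₅C F N D w' ∧ w'.C = w.C ∧ w'.up = w.up ∧ w'.L = w.L ∧ w'.em = w.em ∧ w'.ep = w.ep ∧
      0 < w'.γ ∧ w'.γ ≤ w.γ ∧
      ((∀ P : B12.RunParams, Dag.B8_main (leavesP w' P)) → (∀ P : B12.RunParams, Dag.B9_main (leavesP w' P)) →
        (∀ P : B12.RunParams, Dag.B11_main (leavesP w' P)) → (∀ P : B12.RunParams, Dag.B12_main (leavesP w' P)) →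
        (∀ P : B12.RunParams, Dag.B15_main (leavesP w' P)) →
        (∀ θ : Stage5Params F N, θ.Admissible → D = datumOfRecord₅ F N θ →
          (∀ P, w'.up P = upOfRecord₅C F N θ P) → ∀ P : B12.RunParams,
            ∃ S Scorr : (k : ℕ) → Density (F.P P.K) k (SU N) → Prop,
              (ROpLeaf (θ.res.V P) → B14.RAssumedP244 (θ.res.R P) Scorr S P.K) ∧
              (∀ k, k ≤ P.K → S k (densOfRecord₅ F N θ P k) → θ.res.S218 P k (densOfRecord₅ F N θ P k)) ∧
              ((leavesP w' P).smallCouplings → S 0 (rhoZeroOfRecord F N P.K P.g0 (θ.res.E P))) ∧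
              ((leavesP w' P).b7 → (leavesP w' P).b8 → (leavesP w' P).b9 → (leavesP w' P).b10 → (leavesP w' P).b11 →
                (leavesP w' P).smallCouplings → (leavesP w' P).smallFieldInductive → (leavesP w' P).flowControl →
                  ∀ k, k < P.K → S k (densOfRecord₅ F N θ P k) →
                    Scorr (k + 1) (TrhoOfRecord F N P.K k (densOfRecord₅ F N θ P k)))) →
        ∀ (eM eP : FiniteEpsData F (SU N) → ℝ → ℝ), (∀ P : B12.RunParams, (w'.up P).rOperation) →
        (∀ θ : Stage5Params F N, θ.Admissible → D = datumOfRecord₅ F N θ →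
          ∃ R : B14Cor3.ReprFamily (datumOfRecord₅ F N θ).C,
            B14Cor3.LeafH (datumOfRecord₅ F N θ).C R w'.γ ∧ B14Cor3.LeafU1 (datumOfRecord₅ F N θ).C R w'.γ ∧
            B14Cor3.LeafU2 (datumOfRecord₅ F N θ).C R w'.γ (eP D) ∧ B14Cor3.LeafL1 (datumOfRecord₅ F N θ).C R w'.γ ∧
            B14Cor3.LeafL2 (datumOfRecord₅ F N θ).C R w'.γ (eM D)) →
        B16.EndStatementBPrinted D.C) := by
  obtain ⟨γβ, b, βup, hγβ, hb, hlo, hhi⟩ := N24_betaBox_of_betaPertH hbar hP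
  have hwγ : 0 < w.γ := gamma_pos_of_isRecordOfRecord₅C h
  have hγ' : 0 < min w.γ γβ := lt_min hwγ hγβ
  have h' : IsRecordOfRecord₅C F N D { w with γ := min w.γ γβ, b := b, b_pos := hb, βup := βup, em := w.em, ep := w.ep } :=
    N24_isRecordOfRecord₅C_reletter h hγ' hb βup w.em w.ep
  refine ⟨{ w with γ := min w.γ γβ, b := b, b_pos := hb, βup := βup, em := w.em, ep := w.ep }, h', rfl, rfl, rfl, rfl, rfl, hγ',
    min_le_left _ _, fun h05 h06 h07 h09 h12 slots₁₁ eM eP hR hcor => ?_⟩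
  exact N24_at_record₅C_knit₀₃₀₈₁₀₁₁₁₃_pinned h' le_rfl h05 h06 h07 h09 h12 slots₀₈ slots₁₀ slots₁₁ eM eP hR hcor
    (fun k v hv => hlo k v (box_mono (min_le_right _ _) k hv)) fun k v hv => hhi k v (box_mono (min_le_right _ _) k hv)

end Literature.MathematicalPhysics.QuantumFieldTheory.Balaban1983to89.Node00

end
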